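import Summits.Ventures.CertifiedManyBodySolver.Upper.GaugedShibaDWaveSourceOpenBox
import HarnessLib

/-!
# From the readers' rows to the claim node, in the producers' frame, in ONE theorem

HONEST FRAMING: first certified bounds; not a superconductivity verdict. Nothing here is a number or a row. Capstone of
the IRD desk's FORMAT-mpsgf1 chain (`SourcedBoxNodeOfGaugedWitness`, `PartialParticleHoleInvolution`,
`GaugedShibaDWaveSourceOpenBox`, `GaugedShibaNambuEntries`): for the producers' frame
`S′ = partialParticleHole D↓ · orbitalPhase g` (`|g i| = 1`; the production certificates use `g(r↓) = (−1)^{x+y}`,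
`g(r↑) = 1`, whose `H̃` term multiset equals the closed form below term for term — IRD audit leg L on the 32×4 twins),
an exact reader evaluates, for the integer vector `ψ̃` of transformed particle number `Ñ`, the Rayleigh rows of

* the transformed Hamiltonian `H̃ = dΓ(𝓗^ḡ) − μ·ab·1 + U (N↑ − Σ_p n_{p↑} n_{p↓})` (`gaugedShiba'_conjTranspose_conj_dWaveSourceOpenBox`),
* the transformed particle number `Ñ_phys = ab·1 + Σ_p (n_{p↑} − n_{p↓})` (`gaugedShiba'_conjTranspose_conj_totalNumber`, here),

and certifies `Re⟨ψ̃, H̃ψ̃⟩ ≤ e·ab·⟨ψ̃,ψ̃⟩`, `n_lo·ab·⟨ψ̃,ψ̃⟩ ≤ Re⟨ψ̃, Ñ_phys ψ̃⟩ ≤ n_hi·ab·⟨ψ̃,ψ̃⟩`. `sourcedBoxNode_of_producersRows`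
turns exactly these hypotheses — stated with the EXPLICIT operators, no frame unitary left in them — into the
five-conjunct claim node of the certificate files (parity `Ñ + ab`), and `sourcedBoxTwoFieldNode_of_producersRows`
adds hubbard-cq-obsth-2's zero-field window (rows of the `h = 0` closed form of the SAME witness).
Written by the IRD desk (sr-mbsolver-ird-5).
-/

noncomputable section
namespace Summit.Ventures.CertifiedManyBodySolver
open Matrix Finset Literature.Probability.LatticeModels
open Literature.MathematicalPhysics.QuantumLattice Literature.MathematicalPhysics.QuantumLattice.TwoCluster
open Literature.Barriers.HubbardSuperconductivity HubbardWave0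
open scoped ComplexOrder ComplexConjugate

section NumberOperator

variable {Λ : Type*} [LinearOrder Λ] [Fintype Λ]

/-- `S′ᴴ X S′ = Ḡ (W X Wᴴ) Ḡᴴ` for `S′ = W · orbitalPhase g`, `Ḡ = orbitalPhase (star ∘ g)` (the sign of `W² = ±1` squares
away). [cite: Lieb1989, proof of Theorem 2] -/
theorem gaugedShiba'_conjTranspose_conj_eq (g : Orb Λ → ℂ) (X : Matrix (Finset (Orb Λ)) (Finset (Orb Λ)) ℂ) :
    (partialParticleHole (spinDownOrbitals : Finset (Orb Λ)) * orbitalPhase g)ᴴ * X *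
        (partialParticleHole (spinDownOrbitals : Finset (Orb Λ)) * orbitalPhase g) =
      orbitalPhase (star ∘ g) *
        (partialParticleHole (spinDownOrbitals : Finset (Orb Λ)) * X *
          (partialParticleHole (spinDownOrbitals : Finset (Orb Λ)))ᴴ) * (orbitalPhase (star ∘ g))ᴴ := by
  have hGt : (orbitalPhase (star ∘ g))ᴴ = orbitalPhase g := by
    rw [conjTranspose_orbitalPhase]
    congr 1
    funext i
    simp only [Function.comp_apply, star_star]
  rw [conjTranspose_mul, conjTranspose_orbitalPhase g, hGt]
  calc orbitalPhase (star ∘ g) * (partialParticleHole (spinDownOrbitals : Finset (Orb Λ)))ᴴ * X *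
        (partialParticleHole (spinDownOrbitals : Finset (Orb Λ)) * orbitalPhase g)
      = orbitalPhase (star ∘ g) * ((partialParticleHole (spinDownOrbitals : Finset (Orb Λ)))ᴴ * X *
          partialParticleHole (spinDownOrbitals : Finset (Orb Λ))) * orbitalPhase g := by simp only [Matrix.mul_assoc]
    _ = orbitalPhase (star ∘ g) * (partialParticleHole (spinDownOrbitals : Finset (Orb Λ)) * X *
          (partialParticleHole (spinDownOrbitals : Finset (Orb Λ)))ᴴ) * orbitalPhase g := by
        rw [partialParticleHole_conjTranspose_conj_eq]

/-- In the producers' frame the up density is untouched: `S′ᴴ n_{x↑} S′ = n_{x↑}`. [cite: Lieb1989, proof of Theorem 2] -/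
theorem gaugedShiba'_conjTranspose_conj_numberOp_up {g : Orb Λ → ℂ} (hg : ∀ i, ‖g i‖ = 1) (x : Λ) :
    (partialParticleHole (spinDownOrbitals : Finset (Orb Λ)) * orbitalPhase g)ᴴ * numberOp x 0 *
        (partialParticleHole (spinDownOrbitals : Finset (Orb Λ)) * orbitalPhase g) = numberOp x 0 := by
  rw [gaugedShiba'_conjTranspose_conj_eq, partialParticleHole_conj_numberOp_up,
    orbitalPhase_conj_numberOp (norm_star_phase hg)]

/-- … and the down density is particle–hole exchanged: `S′ᴴ n_{x↓} S′ = 1 − n_{x↓}`. [cite: Lieb1989, proof of Theorem 2] -/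
theorem gaugedShiba'_conjTranspose_conj_numberOp_down {g : Orb Λ → ℂ} (hg : ∀ i, ‖g i‖ = 1) (x : Λ) :
    (partialParticleHole (spinDownOrbitals : Finset (Orb Λ)) * orbitalPhase g)ᴴ * numberOp x 1 *
        (partialParticleHole (spinDownOrbitals : Finset (Orb Λ)) * orbitalPhase g) = 1 - numberOp x 1 := by
  rw [gaugedShiba'_conjTranspose_conj_eq, partialParticleHole_conj_numberOp_down, Matrix.mul_sub, Matrix.sub_mul,
    Matrix.mul_one, orbitalPhase_mul_conjTranspose (norm_star_phase hg), orbitalPhase_conj_numberOp (norm_star_phase hg)]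

/-- **The transformed particle number**: `S′ᴴ N S′ = |Λ|·1 + Σ_x (n_{x↑} − n_{x↓})` — the readers' `N_phys = ab + N_a − N_b`
(FORMAT-mpsgf1 §2: `Ñ = N↑ + ab − N↓`). [cite: Lieb1989, proof of Theorem 2] -/
theorem gaugedShiba'_conjTranspose_conj_totalNumber {g : Orb Λ → ℂ} (hg : ∀ i, ‖g i‖ = 1) :
    (partialParticleHole (spinDownOrbitals : Finset (Orb Λ)) * orbitalPhase g)ᴴ * totalNumber *
        (partialParticleHole (spinDownOrbitals : Finset (Orb Λ)) * orbitalPhase g) =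
      (Fintype.card Λ : ℂ) • (1 : Matrix (Finset (Orb Λ)) (Finset (Orb Λ)) ℂ) +
        ∑ x : Λ, (numberOp x 0 - numberOp x 1) := by
  rw [totalNumber, Finset.mul_sum, Finset.sum_mul]
  have hx : ∀ x : Λ, (partialParticleHole (spinDownOrbitals : Finset (Orb Λ)) * orbitalPhase g)ᴴ *
        (∑ σ : Fin 2, numberOp x σ) * (partialParticleHole (spinDownOrbitals : Finset (Orb Λ)) * orbitalPhase g) =
      1 + (numberOp x 0 - numberOp x 1) := by
    intro x
    rw [Fin.sum_univ_two, Matrix.mul_add, Matrix.add_mul, gaugedShiba'_conjTranspose_conj_numberOp_up hg,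
      gaugedShiba'_conjTranspose_conj_numberOp_down hg]
    abel
  simp only [hx, Finset.sum_add_distrib, Finset.sum_const, Finset.card_univ]
  rw [← Nat.cast_smul_eq_nsmul ℂ]

end NumberOperator

section ProducersRows

variable (a b : ℕ)

/-- **From the readers' rows to the five-conjunct claim node (producers' frame).** Hypotheses: `ψ̃` has transformed
particle number `Ñ` and `⟨ψ̃,ψ̃⟩ > 0`; the EXPLICIT transformed Hamiltonian `dΓ(𝓗^ḡ) − μ·ab·1 + U(N↑ − Σ n↑n↓)` and the
EXPLICIT transformed particle number `ab·1 + Σ(n↑ − n↓)` satisfy the certified cleared Rayleigh rows. Conclusion: the claim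
node of the certificate files with parity `Ñ + ab`. [cite: Lieb1989, proof of Theorem 2] -/
theorem sourcedBoxNode_of_producersRows (U μ h : ℝ) (e nlo nhi : ℚ) {g : Orb (Fin a ×ₗ Fin b) → ℂ}
    (hg : ∀ i, ‖g i‖ = 1) {Nt : ℕ} (ψt : Fock (Orb (Fin a ×ₗ Fin b))) (hN : IsNParticle Nt ψt)
    (hpos : 0 < (star ψt ⬝ᵥ ψt).re)
    (hE : (star ψt ⬝ᵥ ((dGamma (Matrix.of fun i j => star (g i) * g j *
            bdgNambuMatrix
              (fun x y : Fin a ×ₗ Fin b => if (rectBoxGraph a b).Adj x y then -(1 : ℂ) else 0)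
              (fun u v : Fin a ×ₗ Fin b => -(h : ℂ) * dWaveBoxPairWeight a b (u, v)) μ i j) -
          ((μ : ℂ) * ((a : ℂ) * (b : ℂ))) • (1 : Matrix (Finset (Orb (Fin a ×ₗ Fin b))) (Finset (Orb (Fin a ×ₗ Fin b))) ℂ) +
          (U : ℂ) • ((∑ x : Fin a ×ₗ Fin b, numberOp x 0) - ∑ x : Fin a ×ₗ Fin b, numberOp x 0 * numberOp x 1)) *ᵥ ψt)).re
          ≤ (e : ℝ) * ((a : ℝ) * b) * (star ψt ⬝ᵥ ψt).re)
    (hlo : (nlo : ℝ) * ((a : ℝ) * b) * (star ψt ⬝ᵥ ψt).re ≤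
          (star ψt ⬝ᵥ ((((Fintype.card (Fin a ×ₗ Fin b) : ℂ)) •
              (1 : Matrix (Finset (Orb (Fin a ×ₗ Fin b))) (Finset (Orb (Fin a ×ₗ Fin b))) ℂ) +
            ∑ x : Fin a ×ₗ Fin b, (numberOp x 0 - numberOp x 1)) *ᵥ ψt)).re)
    (hhi : (star ψt ⬝ᵥ ((((Fintype.card (Fin a ×ₗ Fin b) : ℂ)) •
              (1 : Matrix (Finset (Orb (Fin a ×ₗ Fin b))) (Finset (Orb (Fin a ×ₗ Fin b))) ℂ) +
            ∑ x : Fin a ×ₗ Fin b, (numberOp x 0 - numberOp x 1)) *ᵥ ψt)).re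
          ≤ (nhi : ℝ) * ((a : ℝ) * b) * (star ψt ⬝ᵥ ψt).re) :
    ∃ ψ : Fock (Orb (Fin a ×ₗ Fin b)), HasParity (Nt + a * b) ψ ∧ star ψ ⬝ᵥ ψ = 1 ∧
      (star ψ ⬝ᵥ (dWaveSourceOpenBox a b U μ h *ᵥ ψ)).re ≤ ((e : ℚ) : ℝ) * ((a : ℝ) * b) ∧
      ((nlo : ℚ) : ℝ) * ((a : ℝ) * b) ≤ (star ψ ⬝ᵥ (totalNumber *ᵥ ψ)).re ∧
      (star ψ ⬝ᵥ (totalNumber *ᵥ ψ)).re ≤ ((nhi : ℚ) : ℝ) * ((a : ℝ) * b) := by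
  rw [← gaugedShiba'_conjTranspose_conj_dWaveSourceOpenBox a b U μ h hg] at hE
  rw [← gaugedShiba'_conjTranspose_conj_totalNumber hg] at hlo hhi
  exact sourcedBoxNode_of_gaugedShibaWitness' a b U μ h e nlo nhi hg ψt hN hpos hE hlo hhi

/-- **The TWO-FIELD claim node in the other gauged order** `S′ = W · orbitalPhase g` (seven conjuncts).
[cite: Lieb1989, proof of Theorem 2] -/
theorem sourcedBoxTwoFieldNode_of_gaugedShibaWitness' (U μ h : ℝ) (e nlo nhi e0lo e0hi : ℚ)
    {g : Orb (Fin a ×ₗ Fin b) → ℂ} (hg : ∀ i, ‖g i‖ = 1) {Nt : ℕ} (ψt : Fock (Orb (Fin a ×ₗ Fin b)))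
    (hN : IsNParticle Nt ψt) (hpos : 0 < (star ψt ⬝ᵥ ψt).re)
    (hE : (star ψt ⬝ᵥ (((partialParticleHole (spinDownOrbitals : Finset (Orb (Fin a ×ₗ Fin b))) * orbitalPhase g)ᴴ *
            dWaveSourceOpenBox a b U μ h *
            (partialParticleHole (spinDownOrbitals : Finset (Orb (Fin a ×ₗ Fin b))) * orbitalPhase g)) *ᵥ ψt)).re
          ≤ (e : ℝ) * ((a : ℝ) * b) * (star ψt ⬝ᵥ ψt).re)
    (hlo : (nlo : ℝ) * ((a : ℝ) * b) * (star ψt ⬝ᵥ ψt).re ≤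
          (star ψt ⬝ᵥ (((partialParticleHole (spinDownOrbitals : Finset (Orb (Fin a ×ₗ Fin b))) * orbitalPhase g)ᴴ *
            totalNumber *
            (partialParticleHole (spinDownOrbitals : Finset (Orb (Fin a ×ₗ Fin b))) * orbitalPhase g)) *ᵥ ψt)).re)
    (hhi : (star ψt ⬝ᵥ (((partialParticleHole (spinDownOrbitals : Finset (Orb (Fin a ×ₗ Fin b))) * orbitalPhase g)ᴴ *
            totalNumber *
            (partialParticleHole (spinDownOrbitals : Finset (Orb (Fin a ×ₗ Fin b))) * orbitalPhase g)) *ᵥ ψt)).re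
          ≤ (nhi : ℝ) * ((a : ℝ) * b) * (star ψt ⬝ᵥ ψt).re)
    (h0lo : (e0lo : ℝ) * ((a : ℝ) * b) * (star ψt ⬝ᵥ ψt).re ≤
          (star ψt ⬝ᵥ (((partialParticleHole (spinDownOrbitals : Finset (Orb (Fin a ×ₗ Fin b))) * orbitalPhase g)ᴴ *
            dWaveSourceOpenBox a b U μ 0 *
            (partialParticleHole (spinDownOrbitals : Finset (Orb (Fin a ×ₗ Fin b))) * orbitalPhase g)) *ᵥ ψt)).re)
    (h0hi : (star ψt ⬝ᵥ (((partialParticleHole (spinDownOrbitals : Finset (Orb (Fin a ×ₗ Fin b))) * orbitalPhase g)ᴴ *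
            dWaveSourceOpenBox a b U μ 0 *
            (partialParticleHole (spinDownOrbitals : Finset (Orb (Fin a ×ₗ Fin b))) * orbitalPhase g)) *ᵥ ψt)).re
          ≤ (e0hi : ℝ) * ((a : ℝ) * b) * (star ψt ⬝ᵥ ψt).re) :
    ∃ ψ : Fock (Orb (Fin a ×ₗ Fin b)), HasParity (Nt + a * b) ψ ∧ star ψ ⬝ᵥ ψ = 1 ∧
      (star ψ ⬝ᵥ (dWaveSourceOpenBox a b U μ h *ᵥ ψ)).re ≤ ((e : ℚ) : ℝ) * ((a : ℝ) * b) ∧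
      ((nlo : ℚ) : ℝ) * ((a : ℝ) * b) ≤ (star ψ ⬝ᵥ (totalNumber *ᵥ ψ)).re ∧
      (star ψ ⬝ᵥ (totalNumber *ᵥ ψ)).re ≤ ((nhi : ℚ) : ℝ) * ((a : ℝ) * b) ∧
      ((e0lo : ℚ) : ℝ) * ((a : ℝ) * b) ≤ (star ψ ⬝ᵥ (dWaveSourceOpenBox a b U μ 0 *ᵥ ψ)).re ∧
      (star ψ ⬝ᵥ (dWaveSourceOpenBox a b U μ 0 *ᵥ ψ)).re ≤ ((e0hi : ℚ) : ℝ) * ((a : ℝ) * b) :=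
  sourcedBoxTwoFieldNode_of_unitaryFrameWitness a b U μ h e nlo nhi e0lo e0hi _
    (conjTranspose_mul_self_of_mul (partialParticleHole_conjTranspose_mul _) (conjTranspose_orbitalPhase_mul hg)) ψt
    (hasParity_gaugedShiba'_mulVec a b g hN) hpos hE hlo hhi h0lo h0hi

/-- **From the readers' rows to the TWO-FIELD claim node (producers' frame, explicit operators)**: as
`sourcedBoxNode_of_producersRows`, plus the cleared rows of the `h = 0` closed form
`dΓ(𝓗^ḡ|_{h=0}) − μ·ab·1 + U(N↑ − Σ n↑n↓)` of the SAME witness (for an exact reader: `E_mu0 + κ·X`).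
[cite: Lieb1989, proof of Theorem 2] -/
theorem sourcedBoxTwoFieldNode_of_producersRows (U μ h : ℝ) (e nlo nhi e0lo e0hi : ℚ) {g : Orb (Fin a ×ₗ Fin b) → ℂ}
    (hg : ∀ i, ‖g i‖ = 1) {Nt : ℕ} (ψt : Fock (Orb (Fin a ×ₗ Fin b))) (hN : IsNParticle Nt ψt)
    (hpos : 0 < (star ψt ⬝ᵥ ψt).re)
    (hE : (star ψt ⬝ᵥ ((dGamma (Matrix.of fun i j => star (g i) * g j *
            bdgNambuMatrix
              (fun x y : Fin a ×ₗ Fin b => if (rectBoxGraph a b).Adj x y then -(1 : ℂ) else 0)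
              (fun u v : Fin a ×ₗ Fin b => -(h : ℂ) * dWaveBoxPairWeight a b (u, v)) μ i j) -
          ((μ : ℂ) * ((a : ℂ) * (b : ℂ))) • (1 : Matrix (Finset (Orb (Fin a ×ₗ Fin b))) (Finset (Orb (Fin a ×ₗ Fin b))) ℂ) +
          (U : ℂ) • ((∑ x : Fin a ×ₗ Fin b, numberOp x 0) - ∑ x : Fin a ×ₗ Fin b, numberOp x 0 * numberOp x 1)) *ᵥ ψt)).re
          ≤ (e : ℝ) * ((a : ℝ) * b) * (star ψt ⬝ᵥ ψt).re)
    (hlo : (nlo : ℝ) * ((a : ℝ) * b) * (star ψt ⬝ᵥ ψt).re ≤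
          (star ψt ⬝ᵥ ((((Fintype.card (Fin a ×ₗ Fin b) : ℂ)) •
              (1 : Matrix (Finset (Orb (Fin a ×ₗ Fin b))) (Finset (Orb (Fin a ×ₗ Fin b))) ℂ) +
            ∑ x : Fin a ×ₗ Fin b, (numberOp x 0 - numberOp x 1)) *ᵥ ψt)).re)
    (hhi : (star ψt ⬝ᵥ ((((Fintype.card (Fin a ×ₗ Fin b) : ℂ)) •
              (1 : Matrix (Finset (Orb (Fin a ×ₗ Fin b))) (Finset (Orb (Fin a ×ₗ Fin b))) ℂ) +
            ∑ x : Fin a ×ₗ Fin b, (numberOp x 0 - numberOp x 1)) *ᵥ ψt)).re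
          ≤ (nhi : ℝ) * ((a : ℝ) * b) * (star ψt ⬝ᵥ ψt).re)
    (h0lo : (e0lo : ℝ) * ((a : ℝ) * b) * (star ψt ⬝ᵥ ψt).re ≤
          (star ψt ⬝ᵥ ((dGamma (Matrix.of fun i j => star (g i) * g j *
            bdgNambuMatrix
              (fun x y : Fin a ×ₗ Fin b => if (rectBoxGraph a b).Adj x y then -(1 : ℂ) else 0)
              (fun u v : Fin a ×ₗ Fin b => -((0 : ℝ) : ℂ) * dWaveBoxPairWeight a b (u, v)) μ i j) -
          ((μ : ℂ) * ((a : ℂ) * (b : ℂ))) • (1 : Matrix (Finset (Orb (Fin a ×ₗ Fin b))) (Finset (Orb (Fin a ×ₗ Fin b))) ℂ) +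
          (U : ℂ) • ((∑ x : Fin a ×ₗ Fin b, numberOp x 0) - ∑ x : Fin a ×ₗ Fin b, numberOp x 0 * numberOp x 1)) *ᵥ ψt)).re)
    (h0hi : (star ψt ⬝ᵥ ((dGamma (Matrix.of fun i j => star (g i) * g j *
            bdgNambuMatrix
              (fun x y : Fin a ×ₗ Fin b => if (rectBoxGraph a b).Adj x y then -(1 : ℂ) else 0)
              (fun u v : Fin a ×ₗ Fin b => -((0 : ℝ) : ℂ) * dWaveBoxPairWeight a b (u, v)) μ i j) -
          ((μ : ℂ) * ((a : ℂ) * (b : ℂ))) • (1 : Matrix (Finset (Orb (Fin a ×ₗ Fin b))) (Finset (Orb (Fin a ×ₗ Fin b))) ℂ) +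
          (U : ℂ) • ((∑ x : Fin a ×ₗ Fin b, numberOp x 0) - ∑ x : Fin a ×ₗ Fin b, numberOp x 0 * numberOp x 1)) *ᵥ ψt)).re
          ≤ (e0hi : ℝ) * ((a : ℝ) * b) * (star ψt ⬝ᵥ ψt).re) :
    ∃ ψ : Fock (Orb (Fin a ×ₗ Fin b)), HasParity (Nt + a * b) ψ ∧ star ψ ⬝ᵥ ψ = 1 ∧
      (star ψ ⬝ᵥ (dWaveSourceOpenBox a b U μ h *ᵥ ψ)).re ≤ ((e : ℚ) : ℝ) * ((a : ℝ) * b) ∧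
      ((nlo : ℚ) : ℝ) * ((a : ℝ) * b) ≤ (star ψ ⬝ᵥ (totalNumber *ᵥ ψ)).re ∧
      (star ψ ⬝ᵥ (totalNumber *ᵥ ψ)).re ≤ ((nhi : ℚ) : ℝ) * ((a : ℝ) * b) ∧
      ((e0lo : ℚ) : ℝ) * ((a : ℝ) * b) ≤ (star ψ ⬝ᵥ (dWaveSourceOpenBox a b U μ 0 *ᵥ ψ)).re ∧
      (star ψ ⬝ᵥ (dWaveSourceOpenBox a b U μ 0 *ᵥ ψ)).re ≤ ((e0hi : ℚ) : ℝ) * ((a : ℝ) * b) := by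
  rw [← gaugedShiba'_conjTranspose_conj_dWaveSourceOpenBox a b U μ h hg] at hE
  rw [← gaugedShiba'_conjTranspose_conj_dWaveSourceOpenBox a b U μ 0 hg] at h0lo h0hi
  rw [← gaugedShiba'_conjTranspose_conj_totalNumber hg] at hlo hhi
  exact sourcedBoxTwoFieldNode_of_gaugedShibaWitness' a b U μ h e nlo nhi e0lo e0hi hg ψt hN hpos hE hlo hhi h0lo h0hi


/-- **The production case `Ñ = ab` (`S^z = 0` of the transformed problem): parity `0`**, literally the first conjunct
`HasParity 0 ψ` of the certificate files (`(ab + ab) % 2 = 0`). Same hypotheses as `sourcedBoxNode_of_producersRows` with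
`IsNParticle (a * b) ψ̃`. [cite: Lieb1989, proof of Theorem 2] -/
theorem sourcedBoxNode_of_producersRows_even (U μ h : ℝ) (e nlo nhi : ℚ) {g : Orb (Fin a ×ₗ Fin b) → ℂ}
    (hg : ∀ i, ‖g i‖ = 1) (ψt : Fock (Orb (Fin a ×ₗ Fin b))) (hN : IsNParticle (a * b) ψt)
    (hpos : 0 < (star ψt ⬝ᵥ ψt).re)
    (hE : (star ψt ⬝ᵥ ((dGamma (Matrix.of fun i j => star (g i) * g j *
            bdgNambuMatrix
              (fun x y : Fin a ×ₗ Fin b => if (rectBoxGraph a b).Adj x y then -(1 : ℂ) else 0)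
              (fun u v : Fin a ×ₗ Fin b => -(h : ℂ) * dWaveBoxPairWeight a b (u, v)) μ i j) -
          ((μ : ℂ) * ((a : ℂ) * (b : ℂ))) • (1 : Matrix (Finset (Orb (Fin a ×ₗ Fin b))) (Finset (Orb (Fin a ×ₗ Fin b))) ℂ) +
          (U : ℂ) • ((∑ x : Fin a ×ₗ Fin b, numberOp x 0) - ∑ x : Fin a ×ₗ Fin b, numberOp x 0 * numberOp x 1)) *ᵥ ψt)).re
          ≤ (e : ℝ) * ((a : ℝ) * b) * (star ψt ⬝ᵥ ψt).re)
    (hlo : (nlo : ℝ) * ((a : ℝ) * b) * (star ψt ⬝ᵥ ψt).re ≤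
          (star ψt ⬝ᵥ ((((Fintype.card (Fin a ×ₗ Fin b) : ℂ)) •
              (1 : Matrix (Finset (Orb (Fin a ×ₗ Fin b))) (Finset (Orb (Fin a ×ₗ Fin b))) ℂ) +
            ∑ x : Fin a ×ₗ Fin b, (numberOp x 0 - numberOp x 1)) *ᵥ ψt)).re)
    (hhi : (star ψt ⬝ᵥ ((((Fintype.card (Fin a ×ₗ Fin b) : ℂ)) •
              (1 : Matrix (Finset (Orb (Fin a ×ₗ Fin b))) (Finset (Orb (Fin a ×ₗ Fin b))) ℂ) +
            ∑ x : Fin a ×ₗ Fin b, (numberOp x 0 - numberOp x 1)) *ᵥ ψt)).re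
          ≤ (nhi : ℝ) * ((a : ℝ) * b) * (star ψt ⬝ᵥ ψt).re) :
    ∃ ψ : Fock (Orb (Fin a ×ₗ Fin b)), HasParity 0 ψ ∧ star ψ ⬝ᵥ ψ = 1 ∧
      (star ψ ⬝ᵥ (dWaveSourceOpenBox a b U μ h *ᵥ ψ)).re ≤ ((e : ℚ) : ℝ) * ((a : ℝ) * b) ∧
      ((nlo : ℚ) : ℝ) * ((a : ℝ) * b) ≤ (star ψ ⬝ᵥ (totalNumber *ᵥ ψ)).re ∧
      (star ψ ⬝ᵥ (totalNumber *ᵥ ψ)).re ≤ ((nhi : ℚ) : ℝ) * ((a : ℝ) * b) := by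
  obtain ⟨ψ, hp, h1, h2, h3, h4⟩ := sourcedBoxNode_of_producersRows a b U μ h e nlo nhi hg ψt hN hpos hE hlo hhi
  exact ⟨ψ, hp.mono (by omega), h1, h2, h3, h4⟩

/-- The production case `Ñ = ab` of the TWO-FIELD node: parity `0`, seven conjuncts. [cite: Lieb1989, proof of Theorem 2] -/
theorem sourcedBoxTwoFieldNode_of_producersRows_even (U μ h : ℝ) (e nlo nhi e0lo e0hi : ℚ)
    {g : Orb (Fin a ×ₗ Fin b) → ℂ} (hg : ∀ i, ‖g i‖ = 1) (ψt : Fock (Orb (Fin a ×ₗ Fin b)))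
    (hN : IsNParticle (a * b) ψt) (hpos : 0 < (star ψt ⬝ᵥ ψt).re)
    (hE : (star ψt ⬝ᵥ ((dGamma (Matrix.of fun i j => star (g i) * g j *
            bdgNambuMatrix
              (fun x y : Fin a ×ₗ Fin b => if (rectBoxGraph a b).Adj x y then -(1 : ℂ) else 0)
              (fun u v : Fin a ×ₗ Fin b => -(h : ℂ) * dWaveBoxPairWeight a b (u, v)) μ i j) -
          ((μ : ℂ) * ((a : ℂ) * (b : ℂ))) • (1 : Matrix (Finset (Orb (Fin a ×ₗ Fin b))) (Finset (Orb (Fin a ×ₗ Fin b))) ℂ) +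
          (U : ℂ) • ((∑ x : Fin a ×ₗ Fin b, numberOp x 0) - ∑ x : Fin a ×ₗ Fin b, numberOp x 0 * numberOp x 1)) *ᵥ ψt)).re
          ≤ (e : ℝ) * ((a : ℝ) * b) * (star ψt ⬝ᵥ ψt).re)
    (hlo : (nlo : ℝ) * ((a : ℝ) * b) * (star ψt ⬝ᵥ ψt).re ≤
          (star ψt ⬝ᵥ ((((Fintype.card (Fin a ×ₗ Fin b) : ℂ)) •
              (1 : Matrix (Finset (Orb (Fin a ×ₗ Fin b))) (Finset (Orb (Fin a ×ₗ Fin b))) ℂ) +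
            ∑ x : Fin a ×ₗ Fin b, (numberOp x 0 - numberOp x 1)) *ᵥ ψt)).re)
    (hhi : (star ψt ⬝ᵥ ((((Fintype.card (Fin a ×ₗ Fin b) : ℂ)) •
              (1 : Matrix (Finset (Orb (Fin a ×ₗ Fin b))) (Finset (Orb (Fin a ×ₗ Fin b))) ℂ) +
            ∑ x : Fin a ×ₗ Fin b, (numberOp x 0 - numberOp x 1)) *ᵥ ψt)).re
          ≤ (nhi : ℝ) * ((a : ℝ) * b) * (star ψt ⬝ᵥ ψt).re)
    (h0lo : (e0lo : ℝ) * ((a : ℝ) * b) * (star ψt ⬝ᵥ ψt).re ≤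
          (star ψt ⬝ᵥ ((dGamma (Matrix.of fun i j => star (g i) * g j *
            bdgNambuMatrix
              (fun x y : Fin a ×ₗ Fin b => if (rectBoxGraph a b).Adj x y then -(1 : ℂ) else 0)
              (fun u v : Fin a ×ₗ Fin b => -((0 : ℝ) : ℂ) * dWaveBoxPairWeight a b (u, v)) μ i j) -
          ((μ : ℂ) * ((a : ℂ) * (b : ℂ))) • (1 : Matrix (Finset (Orb (Fin a ×ₗ Fin b))) (Finset (Orb (Fin a ×ₗ Fin b))) ℂ) +
          (U : ℂ) • ((∑ x : Fin a ×ₗ Fin b, numberOp x 0) - ∑ x : Fin a ×ₗ Fin b, numberOp x 0 * numberOp x 1)) *ᵥ ψt)).re)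
    (h0hi : (star ψt ⬝ᵥ ((dGamma (Matrix.of fun i j => star (g i) * g j *
            bdgNambuMatrix
              (fun x y : Fin a ×ₗ Fin b => if (rectBoxGraph a b).Adj x y then -(1 : ℂ) else 0)
              (fun u v : Fin a ×ₗ Fin b => -((0 : ℝ) : ℂ) * dWaveBoxPairWeight a b (u, v)) μ i j) -
          ((μ : ℂ) * ((a : ℂ) * (b : ℂ))) • (1 : Matrix (Finset (Orb (Fin a ×ₗ Fin b))) (Finset (Orb (Fin a ×ₗ Fin b))) ℂ) +
          (U : ℂ) • ((∑ x : Fin a ×ₗ Fin b, numberOp x 0) - ∑ x : Fin a ×ₗ Fin b, numberOp x 0 * numberOp x 1)) *ᵥ ψt)).re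
          ≤ (e0hi : ℝ) * ((a : ℝ) * b) * (star ψt ⬝ᵥ ψt).re) :
    ∃ ψ : Fock (Orb (Fin a ×ₗ Fin b)), HasParity 0 ψ ∧ star ψ ⬝ᵥ ψ = 1 ∧
      (star ψ ⬝ᵥ (dWaveSourceOpenBox a b U μ h *ᵥ ψ)).re ≤ ((e : ℚ) : ℝ) * ((a : ℝ) * b) ∧
      ((nlo : ℚ) : ℝ) * ((a : ℝ) * b) ≤ (star ψ ⬝ᵥ (totalNumber *ᵥ ψ)).re ∧
      (star ψ ⬝ᵥ (totalNumber *ᵥ ψ)).re ≤ ((nhi : ℚ) : ℝ) * ((a : ℝ) * b) ∧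
      ((e0lo : ℚ) : ℝ) * ((a : ℝ) * b) ≤ (star ψ ⬝ᵥ (dWaveSourceOpenBox a b U μ 0 *ᵥ ψ)).re ∧
      (star ψ ⬝ᵥ (dWaveSourceOpenBox a b U μ 0 *ᵥ ψ)).re ≤ ((e0hi : ℚ) : ℝ) * ((a : ℝ) * b) := by
  obtain ⟨ψ, hp, h1, h2, h3, h4, h5, h6⟩ :=
    sourcedBoxTwoFieldNode_of_producersRows a b U μ h e nlo nhi e0lo e0hi hg ψt hN hpos hE hlo hhi h0lo h0hi
  exact ⟨ψ, hp.mono (by omega), h1, h2, h3, h4, h5, h6⟩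


/-- Clearing a Rayleigh-quotient upper bound: `Re⟨x⟩/R ≤ q` with `R > 0` gives `Re⟨x⟩ ≤ q·R` — the readers print the
quotient (`μ̃_hi ≤ e·ab`), the node theorems take the cleared row. [folklore] -/
theorem clearedRow_of_quotient_le {X R q : ℝ} (hR : 0 < R) (h : X / R ≤ q) : X ≤ q * R :=
  (div_le_iff₀ hR).1 h

/-- … and a Rayleigh-quotient lower bound: `q ≤ Re⟨x⟩/R` gives `q·R ≤ Re⟨x⟩`. [folklore] -/
theorem clearedRow_of_le_quotient {X R q : ℝ} (hR : 0 < R) (h : q ≤ X / R) : q * R ≤ X :=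
  (le_div_iff₀ hR).1 h

/-- **The readers' verdict shape.** Same as `sourcedBoxNode_of_producersRows_even` but with the three hypotheses stated as
bounds on the RAYLEIGH QUOTIENTS `Re⟨ψ̃, H̃ψ̃⟩/⟨ψ̃,ψ̃⟩ ≤ e·ab` and `n_lo·ab ≤ Re⟨ψ̃, Ñ_phys ψ̃⟩/⟨ψ̃,ψ̃⟩ ≤ n_hi·ab` — literally
an interval reader's `μ̃_hi ≤ E_up`, `[N_lo, N_hi] ∋ Ñ` lines (FORMAT-mpsgf1 R1). [cite: Lieb1989, proof of Theorem 2] -/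
theorem sourcedBoxNode_of_producersQuotients_even (U μ h : ℝ) (e nlo nhi : ℚ) {g : Orb (Fin a ×ₗ Fin b) → ℂ}
    (hg : ∀ i, ‖g i‖ = 1) (ψt : Fock (Orb (Fin a ×ₗ Fin b))) (hN : IsNParticle (a * b) ψt)
    (hpos : 0 < (star ψt ⬝ᵥ ψt).re)
    (hE : (star ψt ⬝ᵥ ((dGamma (Matrix.of fun i j => star (g i) * g j *
            bdgNambuMatrix
              (fun x y : Fin a ×ₗ Fin b => if (rectBoxGraph a b).Adj x y then -(1 : ℂ) else 0)
              (fun u v : Fin a ×ₗ Fin b => -(h : ℂ) * dWaveBoxPairWeight a b (u, v)) μ i j) -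
          ((μ : ℂ) * ((a : ℂ) * (b : ℂ))) • (1 : Matrix (Finset (Orb (Fin a ×ₗ Fin b))) (Finset (Orb (Fin a ×ₗ Fin b))) ℂ) +
          (U : ℂ) • ((∑ x : Fin a ×ₗ Fin b, numberOp x 0) - ∑ x : Fin a ×ₗ Fin b, numberOp x 0 * numberOp x 1)) *ᵥ ψt)).re
          / (star ψt ⬝ᵥ ψt).re ≤ (e : ℝ) * ((a : ℝ) * b))
    (hlo : (nlo : ℝ) * ((a : ℝ) * b) ≤
          (star ψt ⬝ᵥ ((((Fintype.card (Fin a ×ₗ Fin b) : ℂ)) •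
              (1 : Matrix (Finset (Orb (Fin a ×ₗ Fin b))) (Finset (Orb (Fin a ×ₗ Fin b))) ℂ) +
            ∑ x : Fin a ×ₗ Fin b, (numberOp x 0 - numberOp x 1)) *ᵥ ψt)).re / (star ψt ⬝ᵥ ψt).re)
    (hhi : (star ψt ⬝ᵥ ((((Fintype.card (Fin a ×ₗ Fin b) : ℂ)) •
              (1 : Matrix (Finset (Orb (Fin a ×ₗ Fin b))) (Finset (Orb (Fin a ×ₗ Fin b))) ℂ) +
            ∑ x : Fin a ×ₗ Fin b, (numberOp x 0 - numberOp x 1)) *ᵥ ψt)).re / (star ψt ⬝ᵥ ψt).re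
          ≤ (nhi : ℝ) * ((a : ℝ) * b)) :
    ∃ ψ : Fock (Orb (Fin a ×ₗ Fin b)), HasParity 0 ψ ∧ star ψ ⬝ᵥ ψ = 1 ∧
      (star ψ ⬝ᵥ (dWaveSourceOpenBox a b U μ h *ᵥ ψ)).re ≤ ((e : ℚ) : ℝ) * ((a : ℝ) * b) ∧
      ((nlo : ℚ) : ℝ) * ((a : ℝ) * b) ≤ (star ψ ⬝ᵥ (totalNumber *ᵥ ψ)).re ∧
      (star ψ ⬝ᵥ (totalNumber *ᵥ ψ)).re ≤ ((nhi : ℚ) : ℝ) * ((a : ℝ) * b) :=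
  sourcedBoxNode_of_producersRows_even a b U μ h e nlo nhi hg ψt hN hpos (clearedRow_of_quotient_le hpos hE)
    (clearedRow_of_le_quotient hpos hlo) (clearedRow_of_quotient_le hpos hhi)

end ProducersRows
end Summit.Ventures.CertifiedManyBodySolver
end
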